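import Literature.AlgebraicGeometry.Motives.HodgeStructureIrreducibleIndexDvdEigenPieces
import Literature.AlgebraicGeometry.Motives.HodgeStructureExteriorPowerOverField
import Literature.AlgebraicGeometry.Motives.HodgeTensorHodgeNumberProofs
import HarnessLib

/-!
# Block arithmetic of the centre of `E_φ` on an irreducible Hodge structure: `dim_ℂ V_σ = Σ_p h^{p,n-p}_σ = d²·m`, the
# multiplicities `r^{p}_σ = h^{p,n-p}_σ / d` sum to `d·m` — Totaro's «`r_ν + s_ν = mq`» for every irreducible Hodge structure

[topic AlgebraicGeometry/Motives]

Layer `Literature/AlgebraicGeometry/Motives`, namespace `Literature.AlgebraicGeometry.Motives.HodgeStructure`; lane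
`lit-hodgefound` (Track 2 foundations library), prover seat `lit-hodgefound-p02`, generation 48, self-proposed row g48-#4 of
`run/shared/lean/pub/lit-hodgefound/SKELETON.md`. THEOREMS ONLY: no definition, no instance, no notation, no named fact
(D-0026 net debt `0`). Sequel of g48-#1/#2 (`HodgeStructureIrreducibleIndexDvd{HodgeNumbers,EigenPieces}`: the index
`d` of `E_φ`, `[E_φ:ℚ] = [Z:ℚ]·d²`; a central number field `E`
acting by `A : EndAction H E`, its blocks `V_σ`, `V^{p,q}_σ = A.eigenPiece σ p q` with `d ∣ dim_ℂ V^{p,q}_σ`; the centre acts as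
such a field with `[E:ℚ] = [Z:ℚ]`), of `WeilTypeCM(Proofs)` (`finrank_iInf_eigenspace_mul_finrank : dim_ℂ V_σ · [E:ℚ] = dim_ℚ V`,
`complexConj_eigenPiece_holds`, `multiplicity`, `multiplicity_add_multiplicity_conjugate_holds`), of
`HodgeStructureExteriorPowerOverField` (`iInf_eigenspace_eq_iSup_eigenPiece : V_σ = ⊕ₚ V^{p,n-p}_σ`) and of
`HodgeTensorHodgeNumberProofs` (`finrank_biSup_eq_sum_of_iSupIndep`).

## The source, verbatim

B. Totaro, *Hodge structures of type `(n,0,…,0,n)`*, IMRN 2015 [Totaro2015HodgeStructuresN00N] (held `paper:arxiv-1402.3666`),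
§3 p0006: «Let `V` be a simple polarizable `ℚ`-Hodge structure of weight `w ≥ 1` with Hodge numbers `(n,0,…,0,n)`. The
endomorphism algebra `L` of `V` is a division algebra […] Let `F₀` be the center of `L` […] Write `g = [F:ℚ]`, `2n = m[L:ℚ]`, and
`q² = [L:F₀]`. For `V` of Type IV, `L ⊗_ℚ ℂ` is isomorphic to the product of `2g` copies of `M_q(ℂ)`. Write the simple
`L ⊗_ℚ ℂ`-modules, each of complex dimension `q`, as `χ₁, …, χ_g, χ̄₁, …, χ̄_g`. Let `r_ν` and `s_ν` be the multiplicities of `χ_ν`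
and `χ̄_ν`, respectively, in the representation of `F₀` on `V^{2,0} ⊂ V ⊗_ℚ ℂ`. Then `r_ν + s_ν = mq` for `ν = 1, …, g`.»
(`q ↝ d`, `m = dim_L V ↝ dim_ℚ V/[E_φ:ℚ]`, `F₀ ↝ Z` acting through the central `A : EndAction H E` with `[E:ℚ] = [Z:ℚ]`, the
block of `χ_ν` ↝ `V_σ`, that of `χ̄_ν` ↝ `V_σ̄`; `q·r_ν = dim V^{w,0}_σ`, `q·s_ν = dim V^{w,0}_σ̄ = dim V^{0,w}_σ`.)

## What is proved

* §1 ANY `A : EndAction H E` (bookkeeping the tree did not have in this form): **`EndAction.finrank_iInf_eigenspace_eq_sum_finrank_eigenPiece`**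
  (`dim_ℂ V_σ = Σ_{p ∈ s} h^{p,n-p}_σ` for any finite `s ⊇ {p ∣ V^{p,n-p} ≠ 0}`), `EndAction.finrank_div_eq_sum_finrank_eigenPiece`
  (`dim_E V = Σ_{p∈s} h^{p,n-p}_σ` for every `σ` — «each embedding occurs the same number of times in `V ⊗ ℂ`»),
  **`EndAction.finrank_eigenPiece_conjugate`** (`h^{p,q}_σ̄ = h^{q,p}_σ`), the TWO-PIECE case `EndAction.finrank_iInf_eigenspace_eq_add_of_two_pieces`
  (only `V^{a,b}`, `V^{b,a}` non-zero ⟹ `dim_ℂ V_σ = h^{a,b}_σ + h^{a,b}_σ̄`).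
* §2 THE CENTRE ON AN IRREDUCIBLE `H` (`hcent`, `hE : [E:ℚ] = [Z:ℚ]`, `hd : [E_φ:ℚ] = [Z:ℚ]·d²`):
  **`IsIrreducible.finrank_iInf_eigenspace_eq_index_sq_mul_of_center`** (`dim_ℂ V_σ = d²·m`, `m = dim_ℚ V/[E_φ:ℚ]`),
  **`IsIrreducible.sum_finrank_eigenPiece_eq_index_sq_mul_of_center`** (`Σ_{p∈s} h^{p,n-p}_σ = d²·m`),
  **`IsIrreducible.sum_finrank_eigenPiece_div_index_eq_of_center`** (`Σ_{p∈s} r^{p}_σ = d·m`, `r^p_σ = h^{p,n-p}_σ/d` an integer by g48-#2),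
  and Totaro's display in its own setting: **`IsIrreducible.finrank_eigenPiece_div_add_conjugate_div_eq_of_two_pieces`** («`r_ν + s_ν = mq`»:
  `h^{a,b}_σ/d + h^{a,b}_σ̄/d = d·m` when only `V^{a,b}, V^{b,a}` are non-zero), the weight-one form
  **`IsIrreducible.multiplicity_div_add_multiplicity_conjugate_div_eq_of_center`** (`n_σ/d + n_σ̄/d = d·m` for an effective
  weight-one `H`), and at a REAL place of the centre in the two-piece case `IsIrreducible.two_mul_finrank_eigenPiece_div_eq_of_two_pieces_of_isReal`
  (`2·r_σ = d·m`).
* §3 EXISTENCE: the hypotheses of §2 are met by the centre itself — `IsIrreducible.exists_center_endAction_sum_finrank_eigenPiece_div_eq`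
  (from g48-#2's `exists_central_endAction_range_eq_center`).

Honest column: the identification of `V_σ` with Totaro's «multiplicity of the simple module `χ_ν`» is by dimension only
(`dim V^{p,q}_σ = d · r`); the simple `E_φ ⊗_{Z,σ} ℂ ≅ M_d(ℂ)`-module itself is not constructed here (the tree has the matrix
splitting on points in p34's `HodgeStructureEndActionCentralBlocks`). No polarization is used.
-/

noncomputable section

open Module NumberField
open scoped TensorProduct

universe u v

namespace Literature.AlgebraicGeometry.Motives.HodgeStructure

variable {V : Type u} [AddCommGroup V] [Module ℚ V] {n : ℤ} {H : HodgeStructure V n}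
variable {E : Type v} [Field E] [NumberField E]

/-! ## §1 Bookkeeping for any field action: `dim V_σ = Σ_p h^{p,n-p}_σ`, `h^{p,q}_σ̄ = h^{q,p}_σ`, the two-piece case -/

namespace EndAction

variable (A : EndAction H E)

/-- `h^{p,q}_σ̄ = h^{q,p}_σ` (`conj V^{q,p}_σ = V^{p,q}_σ̄` and `conj` preserves dimensions; Totaro's «`s_ν` = multiplicity of `χ̄_ν`
in `V^{2,0}`» = dimension count of `V^{0,2}` in the block of `χ_ν`). [cite: Totaro2015HodgeStructuresN00N, §3 (arXiv p0006–p0007)]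
[cite: Deligne1982HodgeCycles, §4 (p. 30)] -/
theorem finrank_eigenPiece_conjugate (σ : E →+* ℂ) (p q : ℤ) :
    finrank ℂ (A.eigenPiece (ComplexEmbedding.conjugate σ) p q) = finrank ℂ (A.eigenPiece σ q p) := by
  rw [← complexConj_eigenPiece_holds A σ q p, finrank_complexConj]

/-- `V^{p,n-p}_σ = 0` off any finite window `s` containing the non-zero Hodge pieces. [cite: Totaro2015HodgeStructuresN00N, §3 proof of Thm. 3.1 (arXiv p0007)] -/
theorem eigenPiece_eq_bot_of_piece_eq_bot (σ : E →+* ℂ) {p q : ℤ} (h : H.piece p q = ⊥) : A.eigenPiece σ p q = ⊥ :=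
  eq_bot_iff.2 (h ▸ A.eigenPiece_le_piece σ p q)

variable [Module.Finite ℚ V]

/-- **`dim_ℂ V_σ = Σ_{p ∈ s} h^{p,n-p}_σ`** for every finite set `s` of integers containing all `p` with `V^{p,n-p} ≠ 0`
(`V_σ = ⊕_p V^{p,n-p}_σ`: «`V^{b,c}` splits as a direct sum of complex linear subspaces on which `F` acts by `σ₁,…,σ_g`»,
summed over the Hodge types inside one block). [cite: Totaro2015HodgeStructuresN00N, §3 proof of Thm. 3.1 (arXiv p0007)]
[cite: Deligne1982HodgeCycles, §4 (p. 30, «H¹_{B,σ} = H^{1,0}_σ ⊕ H^{0,1}_σ»)] -/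
theorem finrank_iInf_eigenspace_eq_sum_finrank_eigenPiece (s : Finset ℤ) (hs : ∀ p, H.piece p (n - p) ≠ ⊥ → p ∈ s)
    (σ : E →+* ℂ) :
    finrank ℂ ↥(⨅ e, Module.End.eigenspace ((A.ι e).baseChange ℂ) (σ e)) = ∑ p ∈ s, finrank ℂ (A.eigenPiece σ p (n - p)) := by
  have hind : iSupIndep fun p : ℤ ↦ A.eigenPiece σ p (n - p) :=
    (iSupIndep_piece_holds H).mono fun p ↦ A.eigenPiece_le_piece σ p (n - p)
  have hsup : (⨅ e, Module.End.eigenspace ((A.ι e).baseChange ℂ) (σ e)) = ⨆ p ∈ s, A.eigenPiece σ p (n - p) := by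
    rw [A.iInf_eigenspace_eq_iSup_eigenPiece σ]
    refine le_antisymm (iSup_le fun p ↦ ?_) (iSup₂_le fun p _ ↦ le_iSup (fun p ↦ A.eigenPiece σ p (n - p)) p)
    by_cases hp : H.piece p (n - p) = ⊥
    · rw [A.eigenPiece_eq_bot_of_piece_eq_bot σ hp]
      exact bot_le
    · exact le_iSup₂_of_le p (hs p hp) le_rfl
  rw [hsup, finrank_biSup_eq_sum_of_iSupIndep hind s]

/-- **`dim_E V = dim_ℚ V/[E:ℚ] = Σ_{p∈s} h^{p,n-p}_σ` for EVERY `σ`** («each embedding `F ↪ ℝ` occurs the same number of times in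
`V ⊗_ℚ ℂ`» — here for all embeddings, real or not). [cite: Totaro2015HodgeStructuresN00N, §3 proof of Thm. 3.1 (arXiv p0007)] -/
theorem finrank_div_eq_sum_finrank_eigenPiece (s : Finset ℤ) (hs : ∀ p, H.piece p (n - p) ≠ ⊥ → p ∈ s) (σ : E →+* ℂ) :
    finrank ℚ V / finrank ℚ E = ∑ p ∈ s, finrank ℂ (A.eigenPiece σ p (n - p)) := by
  rw [Nat.div_eq_of_eq_mul_left (Module.finrank_pos (R := ℚ) (M := E)) (A.finrank_iInf_eigenspace_mul_finrank σ).symm]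
  exact A.finrank_iInf_eigenspace_eq_sum_finrank_eigenPiece s hs σ

/-- **The two-piece case** (Hodge numbers `(h,0,…,0,h)` placed at `(a,b)` and `(b,a)`, `a ≠ b`): `dim_ℂ V_σ = h^{a,b}_σ + h^{a,b}_σ̄`
(`= q r_ν + q s_ν` in Totaro's notation). [cite: Totaro2015HodgeStructuresN00N, §3 (arXiv p0006) «r_ν + s_ν = mq»] -/
theorem finrank_iInf_eigenspace_eq_add_of_two_pieces {a b : ℤ} (hab : a + b = n) (hne : a ≠ b)
    (h0 : ∀ p, p ≠ a → p ≠ b → H.piece p (n - p) = ⊥) (σ : E →+* ℂ) :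
    finrank ℂ ↥(⨅ e, Module.End.eigenspace ((A.ι e).baseChange ℂ) (σ e)) =
      finrank ℂ (A.eigenPiece σ a b) + finrank ℂ (A.eigenPiece (ComplexEmbedding.conjugate σ) a b) := by
  classical
  have hs : ∀ p, H.piece p (n - p) ≠ ⊥ → p ∈ ({a, b} : Finset ℤ) := fun p hp ↦ by
    rw [Finset.mem_insert, Finset.mem_singleton]
    by_contra h
    exact hp (h0 p (fun ha ↦ h (Or.inl ha)) (fun hb ↦ h (Or.inr hb)))
  rw [A.finrank_iInf_eigenspace_eq_sum_finrank_eigenPiece {a, b} hs σ, Finset.sum_pair hne,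
    A.finrank_eigenPiece_conjugate σ a b, show n - a = b by omega, show n - b = a by omega]

end EndAction

/-! ## §2 The centre on an irreducible Hodge structure: `dim V_σ = d²·m`, `Σ_p r^p_σ = d·m` -/

section Centre

variable [Module.Finite ℚ V]

/-- **`dim_ℂ V_σ = d²·m`** (`m = dim_ℚ V/[E_φ:ℚ]`) for every embedding `σ` of a central field `E` with `[E:ℚ] = [Z:ℚ]` (the centre):
`dim_ℂ V_σ · [Z:ℚ] = dim_ℚ V = [E_φ:ℚ]·m = [Z:ℚ]·d²·m` («`L ⊗_ℚ ℂ` is isomorphic to the product of … copies of `M_q(ℂ)`», each block a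
sum of `mq` simple modules of dimension `q`). [cite: Totaro2015HodgeStructuresN00N, §3 (arXiv p0006)] -/
theorem IsIrreducible.finrank_iInf_eigenspace_eq_index_sq_mul_of_center (hirr : H.IsIrreducible) {d : ℕ}
    (hd : finrank ℚ H.endAlg = finrank ℚ (Subalgebra.center ℚ H.endAlg) * d ^ 2) (A : EndAction H E)
    (hE : finrank ℚ E = finrank ℚ (Subalgebra.center ℚ H.endAlg)) (σ : E →+* ℂ) :
    finrank ℂ ↥(⨅ e, Module.End.eigenspace ((A.ι e).baseChange ℂ) (σ e)) = d ^ 2 * (finrank ℚ V / finrank ℚ H.endAlg) := by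
  have h1 := A.finrank_iInf_eigenspace_mul_finrank σ
  have h2 : finrank ℚ H.endAlg * (finrank ℚ V / finrank ℚ H.endAlg) = finrank ℚ V := Nat.mul_div_cancel' hirr.finrank_endAlg_dvd_finrank
  have hZ : 0 < finrank ℚ (Subalgebra.center ℚ H.endAlg) := hirr.finrank_center_endAlg_pos
  set m := finrank ℚ V / finrank ℚ H.endAlg with hm
  refine Nat.eq_of_mul_eq_mul_right hZ ?_
  calc finrank ℂ ↥(⨅ e, Module.End.eigenspace ((A.ι e).baseChange ℂ) (σ e)) * finrank ℚ (Subalgebra.center ℚ H.endAlg)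
      = finrank ℚ V := by rw [← hE, h1]
    _ = finrank ℚ H.endAlg * m := h2.symm
    _ = d ^ 2 * m * finrank ℚ (Subalgebra.center ℚ H.endAlg) := by rw [hd]; ring

/-- **`Σ_{p∈s} h^{p,n-p}_σ = d²·m`** for the centre (any finite window `s` of Hodge types). [cite: Totaro2015HodgeStructuresN00N, §3 (arXiv p0006)] -/
theorem IsIrreducible.sum_finrank_eigenPiece_eq_index_sq_mul_of_center (hirr : H.IsIrreducible) {d : ℕ}
    (hd : finrank ℚ H.endAlg = finrank ℚ (Subalgebra.center ℚ H.endAlg) * d ^ 2) (A : EndAction H E)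
    (hE : finrank ℚ E = finrank ℚ (Subalgebra.center ℚ H.endAlg)) (s : Finset ℤ) (hs : ∀ p, H.piece p (n - p) ≠ ⊥ → p ∈ s)
    (σ : E →+* ℂ) : ∑ p ∈ s, finrank ℂ (A.eigenPiece σ p (n - p)) = d ^ 2 * (finrank ℚ V / finrank ℚ H.endAlg) := by
  rw [← A.finrank_iInf_eigenspace_eq_sum_finrank_eigenPiece s hs σ, hirr.finrank_iInf_eigenspace_eq_index_sq_mul_of_center hd A hE σ]

/-- **`Σ_{p∈s} r^{p}_σ = d·m` with `r^p_σ = h^{p,n-p}_σ / d`** — the multiplicities of the `d`-dimensional simple module in the Hodge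
pieces of one block sum to `d·m` (each `h^{p,n-p}_σ` is a multiple of `d` by g48-#2, so nothing is lost in the division).
[cite: Totaro2015HodgeStructuresN00N, §3 (arXiv p0006) «r_ν + s_ν = mq»] -/
theorem IsIrreducible.sum_finrank_eigenPiece_div_index_eq_of_center (hirr : H.IsIrreducible) {d : ℕ}
    (hd : finrank ℚ H.endAlg = finrank ℚ (Subalgebra.center ℚ H.endAlg) * d ^ 2) (A : EndAction H E)
    (hcent : ∀ a : H.endAlg, ∀ e : E, (a : Module.End ℚ V) * A.ι e = A.ι e * a)
    (hE : finrank ℚ E = finrank ℚ (Subalgebra.center ℚ H.endAlg)) (s : Finset ℤ) (hs : ∀ p, H.piece p (n - p) ≠ ⊥ → p ∈ s)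
    (σ : E →+* ℂ) : ∑ p ∈ s, finrank ℂ (A.eigenPiece σ p (n - p)) / d = d * (finrank ℚ V / finrank ℚ H.endAlg) := by
  have hd0 : 0 < d := hirr.index_pos hd
  refine Nat.eq_of_mul_eq_mul_right hd0 ?_
  rw [Finset.sum_mul, Finset.sum_congr rfl fun p _ ↦ Nat.div_mul_cancel (hirr.index_dvd_finrank_eigenPiece_of_central hd A hcent σ p (n - p)),
    hirr.sum_finrank_eigenPiece_eq_index_sq_mul_of_center hd A hE s hs σ]
  ring

/-- **TOTARO'S «`r_ν + s_ν = mq`»**: when only `V^{a,b}` and `V^{b,a}` (`a ≠ b`) are non-zero, `h^{a,b}_σ/d + h^{a,b}_σ̄/d = d·m` for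
every embedding `σ` of the centre (`r_ν = h^{w,0}_σ/q`, `s_ν = h^{w,0}_σ̄/q`, `q = d`, `m = dim_ℚ V/[E_φ:ℚ]`).
[cite: Totaro2015HodgeStructuresN00N, §3 (arXiv p0006)] -/
theorem IsIrreducible.finrank_eigenPiece_div_add_conjugate_div_eq_of_two_pieces (hirr : H.IsIrreducible) {d : ℕ}
    (hd : finrank ℚ H.endAlg = finrank ℚ (Subalgebra.center ℚ H.endAlg) * d ^ 2) (A : EndAction H E)
    (hcent : ∀ a : H.endAlg, ∀ e : E, (a : Module.End ℚ V) * A.ι e = A.ι e * a)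
    (hE : finrank ℚ E = finrank ℚ (Subalgebra.center ℚ H.endAlg)) {a b : ℤ} (hab : a + b = n) (hne : a ≠ b)
    (h0 : ∀ p, p ≠ a → p ≠ b → H.piece p (n - p) = ⊥) (σ : E →+* ℂ) :
    finrank ℂ (A.eigenPiece σ a b) / d + finrank ℂ (A.eigenPiece (ComplexEmbedding.conjugate σ) a b) / d =
      d * (finrank ℚ V / finrank ℚ H.endAlg) := by
  have hd0 : 0 < d := hirr.index_pos hd
  refine Nat.eq_of_mul_eq_mul_right hd0 ?_
  rw [add_mul, Nat.div_mul_cancel (hirr.index_dvd_finrank_eigenPiece_of_central hd A hcent σ a b),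
    Nat.div_mul_cancel (hirr.index_dvd_finrank_eigenPiece_of_central hd A hcent _ a b),
    ← A.finrank_iInf_eigenspace_eq_add_of_two_pieces hab hne h0 σ, hirr.finrank_iInf_eigenspace_eq_index_sq_mul_of_center hd A hE σ]
  ring

/-- The undivided form: `h^{a,b}_σ + h^{a,b}_σ̄ = d²·m` in the two-piece case. [cite: Totaro2015HodgeStructuresN00N, §3 (arXiv p0006)] -/
theorem IsIrreducible.finrank_eigenPiece_add_conjugate_eq_of_two_pieces (hirr : H.IsIrreducible) {d : ℕ}
    (hd : finrank ℚ H.endAlg = finrank ℚ (Subalgebra.center ℚ H.endAlg) * d ^ 2) (A : EndAction H E)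
    (hE : finrank ℚ E = finrank ℚ (Subalgebra.center ℚ H.endAlg)) {a b : ℤ} (hab : a + b = n) (hne : a ≠ b)
    (h0 : ∀ p, p ≠ a → p ≠ b → H.piece p (n - p) = ⊥) (σ : E →+* ℂ) :
    finrank ℂ (A.eigenPiece σ a b) + finrank ℂ (A.eigenPiece (ComplexEmbedding.conjugate σ) a b) =
      d ^ 2 * (finrank ℚ V / finrank ℚ H.endAlg) := by
  rw [← A.finrank_iInf_eigenspace_eq_add_of_two_pieces hab hne h0 σ, hirr.finrank_iInf_eigenspace_eq_index_sq_mul_of_center hd A hE σ]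

/-- At a REAL place of the centre in the two-piece case: `2·r_σ = d·m` (`σ̄ = σ`). [cite: Totaro2015HodgeStructuresN00N, §3 Thm. 3.1 and proof (arXiv p0006–p0007)] -/
theorem IsIrreducible.two_mul_finrank_eigenPiece_div_eq_of_two_pieces_of_isReal (hirr : H.IsIrreducible) {d : ℕ}
    (hd : finrank ℚ H.endAlg = finrank ℚ (Subalgebra.center ℚ H.endAlg) * d ^ 2) (A : EndAction H E)
    (hcent : ∀ a : H.endAlg, ∀ e : E, (a : Module.End ℚ V) * A.ι e = A.ι e * a)
    (hE : finrank ℚ E = finrank ℚ (Subalgebra.center ℚ H.endAlg)) {a b : ℤ} (hab : a + b = n) (hne : a ≠ b)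
    (h0 : ∀ p, p ≠ a → p ≠ b → H.piece p (n - p) = ⊥) {σ : E →+* ℂ} (hσ : ComplexEmbedding.IsReal σ) :
    2 * (finrank ℂ (A.eigenPiece σ a b) / d) = d * (finrank ℚ V / finrank ℚ H.endAlg) := by
  have h := hirr.finrank_eigenPiece_div_add_conjugate_div_eq_of_two_pieces hd A hcent hE hab hne h0 σ
  rw [ComplexEmbedding.isReal_iff.1 hσ] at h
  omega

/-- **Weight one** (effective, `V_ℂ = V^{1,0} ⊕ V^{0,1}`): `n_σ/d + n_σ̄/d = d·m` for the multiplicities `n_σ = dim V^{1,0}_σ` of the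
centre — the tree's `multiplicity_add_multiplicity_conjugate_holds` (`(n_σ + n_σ̄)·[E:ℚ] = dim_ℚ V`) read with `[E:ℚ] = [Z:ℚ]`,
`dim_ℚ V = [Z:ℚ]·d²·m`, `d ∣ n_σ`. [cite: Totaro2015HodgeStructuresN00N, §3 (arXiv p0006) «r_ν + s_ν = mq»] -/
theorem IsIrreducible.multiplicity_div_add_multiplicity_conjugate_div_eq_of_center {H : HodgeStructure V 1}
    (hirr : H.IsIrreducible) (hH : H.IsEffective) {d : ℕ}
    (hd : finrank ℚ H.endAlg = finrank ℚ (Subalgebra.center ℚ H.endAlg) * d ^ 2) (A : EndAction H E)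
    (hcent : ∀ a : H.endAlg, ∀ e : E, (a : Module.End ℚ V) * A.ι e = A.ι e * a)
    (hE : finrank ℚ E = finrank ℚ (Subalgebra.center ℚ H.endAlg)) (σ : E →+* ℂ) :
    A.multiplicity σ / d + A.multiplicity (ComplexEmbedding.conjugate σ) / d = d * (finrank ℚ V / finrank ℚ H.endAlg) := by
  have hd0 : 0 < d := hirr.index_pos hd
  have hsum : (A.multiplicity σ + A.multiplicity (ComplexEmbedding.conjugate σ)) * finrank ℚ E = finrank ℚ V :=
    EndAction.multiplicity_add_multiplicity_conjugate_holds hH A σ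
  have hV : finrank ℚ H.endAlg * (finrank ℚ V / finrank ℚ H.endAlg) = finrank ℚ V := Nat.mul_div_cancel' hirr.finrank_endAlg_dvd_finrank
  have hZ : 0 < finrank ℚ (Subalgebra.center ℚ H.endAlg) := hirr.finrank_center_endAlg_pos
  set m := finrank ℚ V / finrank ℚ H.endAlg with hm
  have htot : A.multiplicity σ + A.multiplicity (ComplexEmbedding.conjugate σ) = d ^ 2 * m := by
    refine Nat.eq_of_mul_eq_mul_right hZ ?_
    calc (A.multiplicity σ + A.multiplicity (ComplexEmbedding.conjugate σ)) * finrank ℚ (Subalgebra.center ℚ H.endAlg)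
        = finrank ℚ V := by rw [← hE, hsum]
      _ = finrank ℚ H.endAlg * m := hV.symm
      _ = d ^ 2 * m * finrank ℚ (Subalgebra.center ℚ H.endAlg) := by rw [hd]; ring
  refine Nat.eq_of_mul_eq_mul_right hd0 ?_
  rw [add_mul, Nat.div_mul_cancel (hirr.index_dvd_multiplicity_of_central hd A hcent σ),
    Nat.div_mul_cancel (hirr.index_dvd_multiplicity_of_central hd A hcent _), htot]
  ring

end Centre

/-! ## §3 The hypotheses of §2 are met by the centre itself -/

section Existence

variable [Module.Finite ℚ V]

/-- **The centre realises the block arithmetic**: for an irreducible `H` with index `d` there is a number field `K ≅ Z` with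
`[K:ℚ] = [Z:ℚ]` acting centrally, and then for every `σ : K → ℂ` and every finite window `s` of Hodge types
`dim_ℂ V_σ = d²·m` and `Σ_{p∈s} h^{p,n-p}_σ / d = d·m`. [cite: Totaro2015HodgeStructuresN00N, §3 (arXiv p0006)] -/
theorem IsIrreducible.exists_center_endAction_sum_finrank_eigenPiece_div_eq (hirr : H.IsIrreducible) {d : ℕ}
    (hd : finrank ℚ H.endAlg = finrank ℚ (Subalgebra.center ℚ H.endAlg) * d ^ 2) (s : Finset ℤ)
    (hs : ∀ p, H.piece p (n - p) ≠ ⊥ → p ∈ s) :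
    ∃ (K : Type u) (_ : Field K) (_ : NumberField K) (A : EndAction H K),
      finrank ℚ K = finrank ℚ (Subalgebra.center ℚ H.endAlg) ∧
      (∀ a : H.endAlg, ∀ k : K, (a : Module.End ℚ V) * A.ι k = A.ι k * a) ∧
      ∀ σ : K →+* ℂ, finrank ℂ ↥(⨅ k, Module.End.eigenspace ((A.ι k).baseChange ℂ) (σ k)) = d ^ 2 * (finrank ℚ V / finrank ℚ H.endAlg) ∧
        ∑ p ∈ s, finrank ℂ (A.eigenPiece σ p (n - p)) / d = d * (finrank ℚ V / finrank ℚ H.endAlg) := by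
  obtain ⟨K, _, _, A, hK, hcent, -⟩ := hirr.exists_central_endAction_range_eq_center
  exact ⟨K, inferInstance, inferInstance, A, hK, hcent, fun σ ↦
    ⟨hirr.finrank_iInf_eigenspace_eq_index_sq_mul_of_center hd A hK σ,
      hirr.sum_finrank_eigenPiece_div_index_eq_of_center hd A hcent hK s hs σ⟩⟩

end Existence

end Literature.AlgebraicGeometry.Motives.HodgeStructure

end
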